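import Mathlib.NumberTheory.LegendreSymbol.JacobiSymbol
import Mathlib.NumberTheory.LegendreSymbol.ZModChar
import Mathlib.FieldTheory.Galois.Basic
import HarnessLib

/-!
# The Galois data of the genus field of `ℚ(√−2pq)` on Monsky's families `2p₅p₃`, `2p₅p₇` with `(p₅/q) = −1`

Tian, *Congruent numbers and Heegner points*, Camb. J. Math. 2 (2014), Notations (journal pp. 122–123): for
`K = ℚ(√−2n)`, `n = p₀p₁⋯p_k` odd with `p₀ ≡ 3 (4)` and `p_i ≡ 1 (4)`, the genus field is `H₀ = K(√p₀*, …, √p_k*)`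
(`p* = ±p ≡ 1 (4)`), and for a positive divisor `d ∣ n` the Artin symbol `σ_{[𝔭_d]}` of the (ramified) prime
`𝔭_d` above `d` acts on `√ℓ*` (`ℓ ∣ n` prime) by the genus rule

  `σ_{[𝔭_d]} √ℓ* = √ℓ*  iff  (d/ℓ) = 1 (ℓ ∤ d),   iff  ((2n/d)/ℓ) = 1 (ℓ ∣ d)`,

together with the ideal relation `(√−2n) = 𝔭₂ 𝔭_{p₁} ⋯` i.e. `[𝔭₂] = [𝔭_p][𝔭_q]` for `n = pq` (Monsky 1990,
p. 62: "`σ` will denote an automorphism of `ℂ` which fixes `i` and restricts to `σ_m` on `H`, and `τ` will be an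
automorphism of `ℂ` which moves `i` and is trivial on `H`", `m = [𝔭₂]`).

This file evaluates the rule on Monsky's two families with the Legendre proviso `(p/q) = −1` (`p ≡ 5 (8)`,
`q ≡ 3 (4)`; Monsky's cases (13) `2p₃p₅` and (15) `2p₅p₇` with `(p₅/p₇) = −1`, Thms 5.5 / 5.9 (1)) and produces the
Galois data that the Lean transplant of Lemmas 5.4 / 5.8 consumes (`DescentLemmaPoints.lemma54_point`,
`lemma58_point`): writing `√2 := √−2n/(√p·√−q)` and `√q := i·√−q`,

* `σ = σ_m` fixes `i` (Tian Def. 2.7), fixes `√2` iff `q ≡ 3 (8)`, moves `√p`, moves `√q` iff `q ≡ 3 (8)`;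
* `τ = σ_{1+ϖ}` moves `i`, fixes `√2`, `√p` (trivial on `H ⊇ H₀`), moves `√q`

(`galoisData_of_genusRule`; the Legendre-symbol arithmetic: `(2/p) = −1`, `(q/p) = (p/q) = −1` by reciprocity,
`(2/q) = −1` iff `q ≡ 3 (8)`). The rule itself and the relation `m = [𝔭_p][𝔭_q]` are taken as hypotheses (they
are printed facts of the actual class field; here `art : G →* Aut(H/ℚ)` is an abstract homomorphism from an
abelian group, so that the statement applies to any displayed system). Everything is fully proved.

## References

* Y. Tian, Congruent numbers and Heegner points, Camb. J. Math. 2 (2014) 117–161, Notations (pp. 122–123), Def. 2.7.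
  [Tian2014]
* P. Monsky, Mock Heegner points and congruent numbers, Math. Z. 204 (1990) 45–67, p. 62 (σ, τ), p. 52 (genus
  theory of `ℚ(ω)`). [Monsky1990MockHeegner]
-/

noncomputable section

open scoped NumberTheorySymbols

namespace Literature.NumberTheory.EllipticCurves.Monsky1990

/-! ### Legendre-symbol arithmetic on the families -/

/-- `(2/p) = −1` for `p ≡ 5 (mod 8)` (second supplement). [cite: Tian2014, Notations (pp. 122–123)] -/
theorem jacobiSym_two_of_mod_eight_five {p : ℕ} (hp : p % 8 = 5) : J(2 | p) = -1 := by
  rw [jacobiSym.at_two (Nat.odd_iff.mpr (by omega)), ZMod.χ₈_nat_eq_if_mod_eight]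
  simp only [show p % 2 = 1 by omega, hp]
  norm_num

/-- `(2/q) = −1` for `q ≡ 3 (mod 8)`. [cite: Tian2014, Notations (pp. 122–123)] -/
theorem jacobiSym_two_of_mod_eight_three {q : ℕ} (hq : q % 8 = 3) : J(2 | q) = -1 := by
  rw [jacobiSym.at_two (Nat.odd_iff.mpr (by omega)), ZMod.χ₈_nat_eq_if_mod_eight]
  simp only [show q % 2 = 1 by omega, hq]
  norm_num

/-- `(2/q) = 1` for `q ≡ 7 (mod 8)`. [cite: Tian2014, Notations (pp. 122–123)] -/
theorem jacobiSym_two_of_mod_eight_seven {q : ℕ} (hq : q % 8 = 7) : J(2 | q) = 1 := by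
  rw [jacobiSym.at_two (Nat.odd_iff.mpr (by omega)), ZMod.χ₈_nat_eq_if_mod_eight]
  simp only [show q % 2 = 1 by omega, hq]
  norm_num

/-- `(q/p) = (p/q)` for `p ≡ 1 (mod 4)` (quadratic reciprocity). [cite: Tian2014, Notations (pp. 122–123)] -/
theorem jacobiSym_swap_of_mod_four_one {p q : ℕ} (hp : p % 4 = 1) (hq : q % 2 = 1) : J(q | p) = J(p | q) :=
  (jacobiSym.quadratic_reciprocity_one_mod_four hp (Nat.odd_iff.mpr hq)).symm

/-! ### Evaluating the genus rule -/

variable {G : Type*} [CommGroup G] {H : Type*} [Field H] [CharZero H]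

/-- An automorphism sends a square root of `c ∈ H` to `±` itself. [folklore] -/
private theorem map_eq_or_eq_neg (g : H ≃ₐ[ℚ] H) {s c : H} (hs : s ^ 2 = c) (hc : g c = c) :
    g s = s ∨ g s = -s := by
  have : (g s) ^ 2 = s ^ 2 := by rw [← map_pow, hs, hc]
  exact sq_eq_sq_iff_eq_or_eq_neg.mp this

/-- **The Galois data D1 from Tian's genus rule** (Monsky's cases (13) and (15)⁻). Hypotheses: primes `p ≡ 5 (8)`,
`q ≡ 3 (4)` with `(p/q) = −1`; an abelian group `G` with elements `cp, cq, m` (`[𝔭_p], [𝔭_q], [𝔭₂]`) and the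
ideal relation `m = cp·cq`; a homomorphism `art : G →* Aut(H/ℚ)` (`t ↦ σ_t`) and an automorphism `tau`
(`σ_{1+ϖ}`); `i, √p, √−q, √−2n ∈ H`; the genus rule at the four pairs `(d, ℓ) ∈ {p, q}²` in the form
"`σ_{[𝔭_d]}` fixes `√ℓ*` iff the Legendre condition", `σ_t` fixes `i` and `√−2n`, `tau` moves `i` and is
trivial on `√p, √−q, √−2n ∈ H`. Conclusion, with `√2 := √−2n/(√p √−q)` and `√q := i √−q`: `√2² = 2`, `√q² = q`, and
`σ_m` fixes `√2` iff `q ≡ 3 (8)`, `σ_m √p = −√p`, `σ_m` negates `√q` iff `q ≡ 3 (8)`; `tau` fixes `√2`, `√p` and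
negates `√q`. [cite: Tian2014, Notations (pp. 122–123), Def. 2.7 (p. 132)] [cite: Monsky1990MockHeegner, p. 62] -/
theorem galoisData_of_genusRule (art : G →* (H ≃ₐ[ℚ] H)) (tau : H ≃ₐ[ℚ] H) {p q : ℕ} (hp : p.Prime)
    (hq : q.Prime) (hp8 : p % 8 = 5) (hq4 : q % 4 = 3) (hpq : J(p | q) = -1) {cp cq m : G}
    (hm : m = cp * cq) {im sqrtP sqrtNegQ sqrtNegTwoN : H} (him : im ^ 2 = -1) (hP : sqrtP ^ 2 = p)
    (hQ : sqrtNegQ ^ 2 = -q) (hN : sqrtNegTwoN ^ 2 = -(2 * p * q))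
    (r1 : art cp sqrtP = sqrtP ↔ J(2 * q | p) = 1) (r2 : art cp sqrtNegQ = sqrtNegQ ↔ J(p | q) = 1)
    (r3 : art cq sqrtP = sqrtP ↔ J(q | p) = 1) (r4 : art cq sqrtNegQ = sqrtNegQ ↔ J(2 * p | q) = 1)
    (hi : ∀ s, art s im = im) (hN' : ∀ s, art s sqrtNegTwoN = sqrtNegTwoN)
    (hτi : tau im = -im) (hτP : tau sqrtP = sqrtP) (hτQ : tau sqrtNegQ = sqrtNegQ)
    (hτN : tau sqrtNegTwoN = sqrtNegTwoN) :
    (sqrtNegTwoN / (sqrtP * sqrtNegQ)) ^ 2 = 2 ∧ (im * sqrtNegQ) ^ 2 = q ∧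
    (art m (sqrtNegTwoN / (sqrtP * sqrtNegQ)) =
      if q % 8 = 3 then sqrtNegTwoN / (sqrtP * sqrtNegQ) else -(sqrtNegTwoN / (sqrtP * sqrtNegQ))) ∧
    art m sqrtP = -sqrtP ∧
    (art m (im * sqrtNegQ) = if q % 8 = 3 then -(im * sqrtNegQ) else im * sqrtNegQ) ∧
    tau (sqrtNegTwoN / (sqrtP * sqrtNegQ)) = sqrtNegTwoN / (sqrtP * sqrtNegQ) ∧ tau sqrtP = sqrtP ∧
    tau (im * sqrtNegQ) = -(im * sqrtNegQ) := by
  -- the primes are odd and distinct, the square roots non-zero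
  have hp2 : p % 2 = 1 := by omega
  have hq2 : q % 2 = 1 := by omega
  have hp0 : (p : H) ≠ 0 := Nat.cast_ne_zero.mpr hp.ne_zero
  have hq0 : (q : H) ≠ 0 := Nat.cast_ne_zero.mpr hq.ne_zero
  have hsP : sqrtP ≠ 0 := by
    intro h; rw [h, zero_pow two_ne_zero] at hP; exact hp0 hP.symm
  have hsQ : sqrtNegQ ≠ 0 := by
    intro h; rw [h, zero_pow two_ne_zero] at hQ; exact hq0 (neg_eq_zero.mp hQ.symm)
  -- the Legendre symbols
  have j2p : J(2 | p) = -1 := jacobiSym_two_of_mod_eight_five hp8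
  have jqp : J(q | p) = -1 := by rw [jacobiSym_swap_of_mod_four_one (by omega) hq2, hpq]
  have j2qp : J(2 * q | p) = 1 := by rw [jacobiSym.mul_left, j2p, jqp]; norm_num
  have j2pq : J(2 * p | q) = if q % 8 = 3 then 1 else -1 := by
    rw [jacobiSym.mul_left, hpq]
    have : q % 8 = 3 ∨ q % 8 = 7 := by omega
    rcases this with h | h
    · rw [if_pos h, jacobiSym_two_of_mod_eight_three h]; norm_num
    · rw [if_neg (by omega), jacobiSym_two_of_mod_eight_seven h]; norm_num
  -- the actions of `σ_{[𝔭_p]}` and `σ_{[𝔭_q]}`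
  have hcpP : art cp sqrtP = sqrtP := r1.mpr j2qp
  have hcpQ : art cp sqrtNegQ = -sqrtNegQ := by
    have hne : art cp sqrtNegQ ≠ sqrtNegQ := fun h => by rw [r2, hpq] at h; norm_num at h
    rcases map_eq_or_eq_neg (art cp) hQ (by rw [map_neg, map_natCast]) with h | h
    · exact absurd h hne
    · exact h
  have hcqP : art cq sqrtP = -sqrtP := by
    have hne : art cq sqrtP ≠ sqrtP := fun h => by rw [r3, jqp] at h; norm_num at h
    rcases map_eq_or_eq_neg (art cq) hP (by rw [map_natCast]) with h | h
    · exact absurd h hne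
    · exact h
  have hcqQ : art cq sqrtNegQ = if q % 8 = 3 then sqrtNegQ else -sqrtNegQ := by
    by_cases h3 : q % 8 = 3
    · rw [if_pos h3]; exact r4.mpr (by rw [j2pq, if_pos h3])
    · rw [if_neg h3]
      have hne : art cq sqrtNegQ ≠ sqrtNegQ := fun h => by
        rw [r4, j2pq, if_neg h3] at h; norm_num at h
      rcases map_eq_or_eq_neg (art cq) hQ (by rw [map_neg, map_natCast]) with h | h
      · exact absurd h hne
      · exact h
  -- `σ_m = σ_{[𝔭_p]} σ_{[𝔭_q]}`
  have hmP : art m sqrtP = -sqrtP := by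
    rw [hm, map_mul, AlgEquiv.mul_apply, hcqP, map_neg, hcpP]
  have hmQ : art m sqrtNegQ = if q % 8 = 3 then -sqrtNegQ else sqrtNegQ := by
    rw [hm, map_mul, AlgEquiv.mul_apply, hcqQ]
    by_cases h3 : q % 8 = 3
    · rw [if_pos h3, if_pos h3, hcpQ]
    · rw [if_neg h3, if_neg h3, map_neg, hcpQ, neg_neg]
  refine ⟨?_, ?_, ?_, hmP, ?_, ?_, hτP, ?_⟩
  · rw [div_pow, mul_pow, hN, hP, hQ]
    field_simp
  · rw [mul_pow, him, hQ]; ring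
  · rw [map_div₀, map_mul, hN' m, hmP, hmQ]
    by_cases h3 : q % 8 = 3
    · rw [if_pos h3, if_pos h3, mul_neg, neg_mul, neg_neg]
    · rw [if_neg h3, if_neg h3, neg_mul, div_neg]
  · rw [map_mul, hi m, hmQ]
    by_cases h3 : q % 8 = 3
    · rw [if_pos h3, if_pos h3, mul_neg]
    · rw [if_neg h3, if_neg h3]
  · rw [map_div₀, map_mul, hτN, hτP, hτQ]
  · rw [map_mul, hτi, hτQ, neg_mul]

/-- **The actions of the ramified classes `[𝔭_p]`, `[𝔭_q]` on `√p`, `√−q`** from Tian's genus rule on the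
families (the values used by `GenusClassGroupFacts`): `σ_{[𝔭_p]}` fixes `√p` (`(2q/p) = 1`) and negates `√−q`
(`(p/q) = −1`); `σ_{[𝔭_q]}` negates `√p` (`(q/p) = −1`) and fixes `√−q` iff `q ≡ 3 (8)` (`(2p/q) = −(2/q)`).
[cite: Tian2014, Notations (pp. 122–123)] -/
theorem ramifiedClassActions_of_genusRule (art : G →* (H ≃ₐ[ℚ] H)) {p q : ℕ}
    (hp8 : p % 8 = 5) (hq4 : q % 4 = 3) (hpq : J(p | q) = -1) {cp cq : G}
    {sqrtP sqrtNegQ : H} (hP : sqrtP ^ 2 = p) (hQ : sqrtNegQ ^ 2 = -q)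
    (r1 : art cp sqrtP = sqrtP ↔ J(2 * q | p) = 1) (r2 : art cp sqrtNegQ = sqrtNegQ ↔ J(p | q) = 1)
    (r3 : art cq sqrtP = sqrtP ↔ J(q | p) = 1) (r4 : art cq sqrtNegQ = sqrtNegQ ↔ J(2 * p | q) = 1) :
    art cp sqrtP = sqrtP ∧ art cp sqrtNegQ = -sqrtNegQ ∧ art cq sqrtP = -sqrtP ∧
      art cq sqrtNegQ = (if q % 8 = 3 then sqrtNegQ else -sqrtNegQ) := by
  have hq2 : q % 2 = 1 := by omega
  have j2p : J(2 | p) = -1 := jacobiSym_two_of_mod_eight_five hp8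
  have jqp : J(q | p) = -1 := by rw [jacobiSym_swap_of_mod_four_one (by omega) hq2, hpq]
  have j2qp : J(2 * q | p) = 1 := by rw [jacobiSym.mul_left, j2p, jqp]; norm_num
  have j2pq : J(2 * p | q) = if q % 8 = 3 then 1 else -1 := by
    rw [jacobiSym.mul_left, hpq]
    have : q % 8 = 3 ∨ q % 8 = 7 := by omega
    rcases this with h | h
    · rw [if_pos h, jacobiSym_two_of_mod_eight_three h]; norm_num
    · rw [if_neg (by omega), jacobiSym_two_of_mod_eight_seven h]; norm_num
  refine ⟨r1.mpr j2qp, ?_, ?_, ?_⟩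
  · have hne : art cp sqrtNegQ ≠ sqrtNegQ := fun h => by rw [r2, hpq] at h; norm_num at h
    rcases map_eq_or_eq_neg (art cp) hQ (by rw [map_neg, map_natCast]) with h | h
    · exact absurd h hne
    · exact h
  · have hne : art cq sqrtP ≠ sqrtP := fun h => by rw [r3, jqp] at h; norm_num at h
    rcases map_eq_or_eq_neg (art cq) hP (by rw [map_natCast]) with h | h
    · exact absurd h hne
    · exact h
  · by_cases h3 : q % 8 = 3
    · rw [if_pos h3]; exact r4.mpr (by rw [j2pq, if_pos h3])
    · rw [if_neg h3]
      have hne : art cq sqrtNegQ ≠ sqrtNegQ := fun h => by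
        rw [r4, j2pq, if_neg h3] at h; norm_num at h
      rcases map_eq_or_eq_neg (art cq) hQ (by rw [map_neg, map_natCast]) with h | h
      · exact absurd h hne
      · exact h

/-- `p` and `q` are odd primes, so `√p ≠ 0` and `√−q ≠ 0`. [cite: Tian2014, Notations (pp. 122–123)] -/
theorem sqrt_ne_zero_of_prime {p q : ℕ} (hp : p.Prime) (hq : q.Prime) {sqrtP sqrtNegQ : H}
    (hP : sqrtP ^ 2 = p) (hQ : sqrtNegQ ^ 2 = -q) : sqrtP ≠ 0 ∧ sqrtNegQ ≠ 0 := by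
  have hp0 : (p : H) ≠ 0 := Nat.cast_ne_zero.mpr hp.ne_zero
  have hq0 : (q : H) ≠ 0 := Nat.cast_ne_zero.mpr hq.ne_zero
  constructor
  · intro h; rw [h, zero_pow two_ne_zero] at hP; exact hp0 hP.symm
  · intro h; rw [h, zero_pow two_ne_zero] at hQ; exact hq0 (neg_eq_zero.mp hQ.symm)

end Literature.NumberTheory.EllipticCurves.Monsky1990

end
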